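import Summits.SmoothPoincare4.SmoothPoincare4.Theorems.InformationMetricHadamardAhHadamardFillingStubInstantonCollarPackageTopology
import Summits.SmoothPoincare4.SmoothPoincare4.Theorems.InformationMetricHadamardAhHadamardFillingStubInstantonCollarPackageSmooth
import Summits.SmoothPoincare4.SmoothPoincare4.Theorems.InformationMetricHadamardAhHadamardFillingStubInstantonCollarPackageAsymptotics
import Summits.SmoothPoincare4.SmoothPoincare4.Theorems.InformationMetricHadamardAhHadamardFillingStubCollarPackage
import Literature.Geometry.GaugeTheory.InstantonCollarInformationMetric

/-!
# Stub F `stub_instantonCollarPackage` of line `fisher-sphere-gauss`, conditional form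
(crux `InformationMetricHadamard.AhHadamardFilling`, item stmt-SmoothPoincare4-6014)

`stub_instantonCollarPackage_of`: the registered stub F — the Donaldson–Taubes collar of a smooth
connected model `ι : W → M₁(Σ, g)` of the charge-one instanton moduli space, with the
Groisser–Murray `C⁰` cone asymptotics of the information (Fisher) metric along it — derived from
the cited Literature fact `Literature.Geometry.GaugeTheory.informationMetric_collarAsymptotics`
(Groisser–Murray 1997 Thm. 3.1 packaged with the collar structure of Donaldson 1983 /
Freed–Uhlenbeck 1984 / Uhlenbeck 1982, stated over the tree's `AsdModuliSpace`, `density`,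
`volMeasure` and the parameter manifold `Σ × ℝ`), for metrics `g` satisfying Groisser–Murray's
standing genericity assumption `IsFreedUhlenbeckGeneric g Σ.orientation 1`.

The TRANSFER from the moduli space to the model is the content proved in the tree (lead c5's
wave, all sorry-free): `helper_collarTopologyTransfer` (continuity, injectivity, co-compact far
parts, closure clause of `Φ := ι⁻¹ ∘ Ψ ∘ (σ, l) ↦ (σ, l₀ l/(l₀ + l))`),
`helper_collarSmoothTransfer` (smoothness of `Φ` into the abstract smooth structure of `W`,
through the Hellinger immersion `W → L²(Σ)` — `helper_contMDiffOn_of_comp_immersion`,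
`helper_toLp_family_manifold`) and `helper_collarAsymptoticsTransfer` (the asymptotics clause by
the chain rule `fisherForm(dΦ X, dΦ X) = ∫ (∂ 2√ρ)² = ∫ (∂ρ)²/ρ` and the cone reparametrisation
estimate `|B − C| ≤ 3l/l₀ · C`). This file only assembles them.

References: D. Groisser, M. K. Murray, Ann. Global Anal. Geom. 15 (1997), Thm. 3.1;
S. K. Donaldson, J. Differential Geom. 18 (1983), §§III–IV; D. Freed, K. Uhlenbeck, *Instantons
and Four-Manifolds* (1984), Chs. 8–9.
-/

noncomputable section

-- the prescribed namespace `Summit.<P>.<Sub>.…` duplicates `SmoothPoincare4` (P = Sub)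
set_option linter.dupNamespace false

open scoped Manifold ContDiff Topology ENNReal NNReal
open Set Function MeasureTheory Topology Filter

namespace Summit.SmoothPoincare4.SmoothPoincare4.Cruxes.AhHadamardFilling.FisherSphereGauss

open Literature.Topology.FourManifolds (HomotopySphere)
open Literature.Geometry.Lorentzian (PseudoRiemannianMetric riemannianMeasure)
open Literature.Geometry.GaugeTheory (AsdModuliSpace volMeasure IsFreedUhlenbeckGeneric
  informationMetric_collarAsymptotics)

/-- **F, conditional form (`stub_instantonCollarPackage_of`).** Assume the cited fact
`informationMetric_collarAsymptotics` (Groisser–Murray 1997 Thm. 3.1 with the Donaldson–Taubes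
collar it is stated on). Let `Σ` be a homotopy 4-sphere, `g` a Riemannian metric with
`IsFreedUhlenbeckGeneric g Σ.orientation 1` (every irreducible `g`-ASD connection on `P₁` is
regular), and `ι : W → M₁(Σ, g)` a smooth connected model of the collar component
(`IsModuliModel`) on which the densities are positive and the information form
`𝓘 = fisherForm g hg (hellinger ι)` is positive definite. Then the Donaldson–Taubes collar exists
IN `W`: `Φ : Σ × ℝ → W`, smooth and injective on `Σ × (0,1)`, with co-compact far parts and the
closure clause, along which `𝓘` is `C⁰`-asymptotic to `c (dλ² + g)/λ²`. Proof: unpack the fact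
(`l₀, c, Ψ`); the collar meets `range ι` (concentration clause + the `R₀`-clause of
`IsModuliModel`), hence lies in it (`Σ` connected, `range ι` clopen); put
`Φ := ι⁻¹ ∘ Ψ ∘ (σ, l) ↦ (σ, l₀ l/(l₀ + l))` and apply the three transfer helpers.
[cite: GroisserMurray1997, Thm. 3.1] -/
theorem stub_instantonCollarPackage_of (hGM : informationMetric_collarAsymptotics)
    (S : HomotopySphere 4) [Nonempty S.carrier]
    (g : PseudoRiemannianMetric (𝓡 4) ∞ (EuclideanSpace ℝ (Fin 4)) (TangentSpace (𝓡 4) : S.carrier → Type _))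
    (hg : g.IsRiemannian) (hgen : IsFreedUhlenbeckGeneric g S.orientation 1)
    (W : Type) [TopologicalSpace W] [ChartedSpace (EuclideanSpace ℝ (Fin 5)) W]
    [IsManifold (𝓡 5) ∞ W] [ConnectedSpace W]
    (ι : W → AsdModuliSpace g S.orientation 1) (hι : IsModuliModel ι)
    (hρ : ∀ (w : W) (x : S.carrier), 0 < (ι w).density g x)
    (hpos : ∀ (w : W) (X : EuclideanSpace ℝ (Fin 5)), X ≠ 0 → 0 < fisherForm g hg (hellinger ι) w X X) :
    ∃ (c : ℝ) (Φ : S.carrier × ℝ → W), 0 < c ∧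
      ContMDiffOn ((𝓡 4).prod 𝓘(ℝ, ℝ)) (𝓡 5) ∞ Φ (univ ×ˢ Ioo (0 : ℝ) 1) ∧
      InjOn Φ (univ ×ˢ Ioo (0 : ℝ) 1) ∧
      (∀ t ∈ Ioo (0 : ℝ) 1, IsCompact (Φ '' (univ ×ˢ Ioo (0 : ℝ) t))ᶜ) ∧
      (∀ t ∈ Ioo (0 : ℝ) 1, closure (Φ '' (univ ×ˢ Ioo (0 : ℝ) t)) ⊆ Φ '' (univ ×ˢ Ioo (0 : ℝ) 1)) ∧
      (∀ ε : ℝ, 0 < ε → ∃ t ∈ Ioo (0 : ℝ) 1, ∀ (x : S.carrier) (l : ℝ), l ∈ Ioo (0 : ℝ) t →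
        ∀ (v : TangentSpace (𝓡 4) x) (s : ℝ),
          |fisherForm g hg (hellinger ι) (Φ (x, l))
                (mfderiv ((𝓡 4).prod 𝓘(ℝ, ℝ)) (𝓡 5) Φ (x, l) (v, s))
                (mfderiv ((𝓡 4).prod 𝓘(ℝ, ℝ)) (𝓡 5) Φ (x, l) (v, s)) -
              c * (s ^ 2 + g.val x v v) / l ^ 2| ≤ ε * (c * (s ^ 2 + g.val x v v) / l ^ 2)) := by
  -- the fact: collar `Ψ`, scale `l₀`, constant `c`
  obtain ⟨l₀, c, Ψ, hl₀, hc, hΨc, hΨi, hco, hclo, hΨρ, hconc, hasym⟩ := hGM S g hg hgen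
  -- `Σ` is connected (it is simply connected)
  haveI : SimplyConnectedSpace S.carrier := Sketch.simplyConnectedSpace_carrier S
  -- the collar meets `range ι`: a sufficiently concentrated class lies in the model
  obtain ⟨hemb, hcl, ⟨R₀, hR₀⟩, -⟩ := id hι
  have hmeet : ∃ p ∈ (univ : Set S.carrier) ×ˢ Ioo (0 : ℝ) l₀, Ψ p ∈ range ι := by
    obtain ⟨t, ht, hct⟩ := hconc R₀
    obtain ⟨σ⟩ := (inferInstance : Nonempty S.carrier)
    have hp : ((σ, t / 2) : S.carrier × ℝ) ∈ (univ : Set S.carrier) ×ˢ Ioo (0 : ℝ) t :=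
      ⟨mem_univ _, by linarith [ht.1], by linarith [ht.1]⟩
    exact ⟨(σ, t / 2), ⟨mem_univ _, by linarith [ht.1], by linarith [ht.1, ht.2]⟩,
      hR₀ _ (hct _ hp)⟩
  -- hence the whole collar lies in `range ι` (`Σ × (0, l₀)` connected, `range ι` clopen)
  have hΨW : ∀ p ∈ (univ : Set S.carrier) ×ˢ Ioo (0 : ℝ) l₀, Ψ p ∈ range ι := by
    have hpc : IsPreconnected (Ψ '' (univ ×ˢ Ioo (0 : ℝ) l₀)) :=
      (isPreconnected_univ.prod isPreconnected_Ioo).image Ψ hΨc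
    obtain ⟨p₀, hp₀, hp₀r⟩ := hmeet
    have hsub : Ψ '' (univ ×ˢ Ioo (0 : ℝ) l₀) ⊆ range ι :=
      hpc.subset_isClopen ⟨hcl, hemb.isOpen_range⟩ ⟨Ψ p₀, mem_image_of_mem Ψ hp₀, hp₀r⟩
    exact fun p hp ↦ hsub (mem_image_of_mem Ψ hp)
  -- the transferred collar `Φ := ι⁻¹ ∘ Ψ ∘ (σ, l) ↦ (σ, l₀ l / (l₀ + l))`
  set Φ : S.carrier × ℝ → W := fun p ↦ Function.invFun ι (Ψ (p.1, l₀ * p.2 / (l₀ + p.2)))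
    with hΦdef
  have hΦ : ∀ p ∈ (univ : Set S.carrier) ×ˢ Ioo (0 : ℝ) 1,
      ι (Φ p) = Ψ (p.1, l₀ * p.2 / (l₀ + p.2)) := by
    intro p hp
    have hmem : (p.1, l₀ * p.2 / (l₀ + p.2)) ∈ (univ : Set S.carrier) ×ˢ Ioo (0 : ℝ) l₀ :=
      ⟨mem_univ _, collarScale_pos hl₀ hp.2.1, collarScale_lt_self hl₀ hp.2.1⟩
    exact Function.invFun_eq (hΨW _ hmem)
  -- topology: continuity, injectivity, co-compact far parts, closure clause
  obtain ⟨-, hΦc, hΦi, hΦco, hΦcl⟩ :=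
    helper_collarTopologyTransfer hemb hcl hl₀ hΨc hΨi hmeet hco hclo hΦ
  -- smoothness into `W` (Hellinger immersion)
  have hΦs : ContMDiffOn ((𝓡 4).prod 𝓘(ℝ, ℝ)) (𝓡 5) ∞ Φ (univ ×ˢ Ioo (0 : ℝ) 1) :=
    helper_collarSmoothTransfer S g hg W ι hι hρ hpos hl₀ hΨρ hΨW hΦ hΦc
  -- the asymptotics clause
  have hΦa := helper_collarAsymptoticsTransfer S g hg W ι hι hρ hl₀ hΨρ hc hasym hΦ hΦs
  exact ⟨c, Φ, hc, hΦs, hΦi, hΦco, hΦcl, hΦa⟩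

end Summit.SmoothPoincare4.SmoothPoincare4.Cruxes.AhHadamardFilling.FisherSphereGauss

end
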